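/-
Copyright (c) 2026 the pub-hodgecm-mathlib formalisation cell (harness21).  Prover seat hodgecm-mathlib-K2E3-p03 (g8), HCML Track B «K2-LIT» ∕ h413
(`stmt-HodgeConjecture-24833`), leaf (nsc-S-A′), brick C1′ NAA («no `A` alone», D131; C1″ NYA by ★ (T) transport): THE FROBENIUS EMBEDDING `ω ↪ D♭(η)` OF AN IRREDUCIBLE `ω`
WITH `E(ω) = {A¹}`.  2026-09-04.
-/
import Summits.HodgeConjecture.HodgeConjecture.Theorems.K2E3GL3PeelKernelZero               -- (this seat) `eq_bot_of_subsingleton_coinvariants`; brings ★ (K-b), Schur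
import Summits.HodgeConjecture.HodgeConjecture.Theorems.K2E3GL3OneLinkNestedHighTower       -- ★ IRR″-c1 (K2E3-p17): brings ★ S2 `exists_peel_linked`, ★ BRIDGE, ★ H0, ★ G1, ★ prodRep, `isOpen_ker_b`
import Summits.HodgeConjecture.HodgeConjecture.Theorems.K2E3GL3OneLinkNestedLowAmbient       -- ★ C1′ L2 (K2E3-p25 g3): `tch_C_ne_A`
import Summits.HodgeConjecture.HodgeConjecture.Theorems.K2E3GL3InductionInStagesLevi         -- ★ (K2E3-p14): `mulSingle_false_mul_mulSingle_true`
import Literature.NumberTheory.Automorphic.ParabolicInductionProofs                            -- ★ `frobenius_reciprocity_gl_holds`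
import HarnessLib

/-!
# Crux `H413` — leaf (nsc-S-A′), brick NAA: an irreducible `ω` with `E(ω) = {A¹}` EMBEDS INTO `D♭(η) = Ind_{P₂₁}(η∘det₂ ⊠ ην½⁻¹)`

Cell `hodgecm-mathlib`, Track B; THEOREMS ONLY; count-neutral helper (`--supports stmt-HodgeConjecture-24833 --as helper`).  Letters `a = ην½⁻¹`, `aν = ην½`,
`A = tch(a, aν, a)`, `C = tch(aν, a, a)`; `Q = P_{(2,1)}` labelled `![false,false,true]`, `W = (r̄_Q ω) ∘ ι_e` the `GL₂`-part of the normalised Jacquet module and `ζ` its `GL₁`-part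
(★ BRIDGE currency), `τ` the `T₂ × GL₁`-action on `r_{U₂}(W)` (★ `exists_prodRep`), `ψ♭ = ψ_Q(η, a) = (η∘det∘ev false)·(a∘det∘ev true)`, `D♭(η) = parabolicIndGL F ![f,f,t] (𝟙.twist ψ♭)`
(= ★ STD-EMB `D η (ην½⁻¹)`, the C1′ standard module; K2E3-p25 (g3) letters 14:45Z).
* §1 `det_reindexGL_symm`.
* §2 **`exists_injective_intertwiningMap_D_low`** — for `ω` IRREDUCIBLE smooth on `GL₃(F)` with finite-dimensional `r_B`, `mult ω A = 1`, no other weight, presented as a subquotient of a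
  smooth `I` carrying the cell hypothesis at `c = ![0,0,1]`: **there is an injective `Φ : ω → D♭(η)`**.  Proof ([BernsteinZelevinsky1977, Prop. 1.9, Thm. 2.5, §2.3], (6b) of
  K2E3-p17's census): the `τ`-weight `(a⊠aν)⊗(a∘det)` occurs ONCE and `(aν⊠a)⊗(a∘det)` not at all (★ BRIDGE `finrank_weightSpace_maxParabolicLeviChar_eq_tch` = `mult ω A`, `mult ω C`);
  ONE ★ S2 peel `exists_peel_linked` gives `K ≤ W`, `W⁄K ≅ η∘det`, `r_{U₂}(K) = 0` (all `τ_K`-weights vanish), so `K = ⊥` (`eq_bot_of_subsingleton_coinvariants`) and `W` acts on ALL of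
  `r̄_Q ω` through `η∘det`; the `τ`-eigenfunctional `λ` of weight `(a⊠aν)⊗(a∘det)` (★ E1b) then makes `q = λ ∘ mk_{U₂} : r̄_Q ω → ℂ` a NON-ZERO `M`-intertwiner into `𝟙.twist ψ♭`
  (`m = ι(m_f)·(1, m_t)` ★ `mulSingle_false_mul_mulSingle_true`, ★ `hτ₂`), and ★ Frobenius `frobenius_reciprocity_gl_holds` at `c = ![f,f,t]` turns `q` into `Φ : ω → D♭(η)`, non-zero
  hence injective (Schur, `ω` irreducible).
Consumer: `K2E3GL3NoWeightAlone` (this seat): `D♭` irreducible (★ F5 ⟸ IRR″) ⇒ `ω ≅ D♭ ∋ B²` ✗ ⇒ NAA(η); NYA(η) by ★ (T) `K2E3GL3NoWeightAloneTransport`.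

HONEST LABEL: HC_CM is proved only modulo the 7 printed citations (2 remaining named inputs: hLiu418 = stmt-HodgeConjecture-24832, h413 =
stmt-HodgeConjecture-24833) until rung 0 closes; count-neutral helper (unconditional given its binders; the cell hypothesis is ★ (CELL-3) at use).

## References
* [BernsteinZelevinsky1977] I. N. Bernstein, A. V. Zelevinsky, *Induced representations of reductive p-adic groups I*, Ann. Sci. ÉNS 10 (1977), Prop. 1.9, §2.3, Cor. 2.13, Thm. 2.5, Thm. 2.9.
* [Zelevinsky1980] A. V. Zelevinsky, *Induced representations of reductive p-adic groups II*, Ann. Sci. ÉNS 13 (1980), §1.2, §1.6, Prop. 2.10, Ex. 3.2.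
* [Casselman1995] W. Casselman, *Introduction to the theory of admissible representations of p-adic reductive groups* (1995), §3.3, §6.3.
-/

set_option autoImplicit false
-- the mandated namespace repeats `HodgeConjecture.HodgeConjecture`, as in every `Theorems/*.lean` of this sub-problem
set_option linter.dupNamespace false

noncomputable section

open Module Module.End Representation Function Literature.NumberTheory.Automorphic Literature.NumberTheory.Automorphic.Zelevinsky1980
open Literature.NumberTheory.GaloisRepresentations.IsNonarchimedeanLocalField Literature.RepresentationTheory.FiniteGroups
open scoped MatrixGroups NNReal
open Summit.HodgeConjecture.HodgeConjecture.Cruxes.H413.K2E3GL3OneLinkNestedHighPieces (isOpen_ker_b)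
open Summit.HodgeConjecture.HodgeConjecture.Cruxes.H413.K2E3GL3PeelLinked (exists_peel_linked)
open Summit.HodgeConjecture.HodgeConjecture.Cruxes.H413.K2E3GL3JacquetInStagesBridge (finrank_weightSpace_maxParabolicLeviChar_eq_tch finrank_weightSpace_eq_of_comp_mu mu_surjective tch_eq_mu
  exists_linearEquiv_coinvariants_stagesMap)
open Summit.HodgeConjecture.HodgeConjecture.Cruxes.H413.K2E3GL3ExponentRules (block_true_mul_comm isSmooth_normalizedJacquetGL exists_blockEquiv_twoOne)
open Summit.HodgeConjecture.HodgeConjecture.Cruxes.H413.K2E3GL2JacquetProdRep (exists_prodRep commute_prodRep)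
open Summit.HodgeConjecture.HodgeConjecture.Cruxes.H413.K2E3JacquetExponentMultiset (subsingleton_of_forall_weightSpace_eq_bot)
open Summit.HodgeConjecture.HodgeConjecture.Cruxes.H413.K2E3JacquetExponentEigenvector (exists_functional_of_weightSpace_ne_bot)
open Summit.HodgeConjecture.HodgeConjecture.Cruxes.H413.K2E3GL3OneLinkNestedLowAmbient (tch_C_ne_A)
open Summit.HodgeConjecture.HodgeConjecture.Cruxes.H413.K2E3GL3InductionInStagesLevi (mulSingle_false_mul_mulSingle_true)
open Summit.HodgeConjecture.HodgeConjecture.Cruxes.H413.K2E3GL3PeelKernelZero (eq_bot_of_subsingleton_coinvariants)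
open Summit.HodgeConjecture.HodgeConjecture.Cruxes.H413

namespace Summit.HodgeConjecture.HodgeConjecture.Cruxes.H413.K2E3GL3NoWeightAAloneEmbedding

variable {F : Type} [Field F] [ValuativeRel F] [TopologicalSpace F] [IsNonarchimedeanLocalField F] (η : Fˣ →* ℂˣ)

/-! ## §1 Letters -/

omit [ValuativeRel F] [TopologicalSpace F] [IsNonarchimedeanLocalField F] in
/-- `det` is invariant under the block relabelling `(reindexGL e)⁻¹`. [folklore] -/
theorem det_reindexGL_symm (e : Fin 2 ≃ {i : Fin 3 // (![false, false, true] : Fin 3 → Bool) i = false}) (g : GL {i : Fin 3 // (![false, false, true] : Fin 3 → Bool) i = false} F) :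
    Matrix.GeneralLinearGroup.det ((reindexGL e).symm g) = Matrix.GeneralLinearGroup.det g :=
  Units.ext (by rw [Matrix.GeneralLinearGroup.val_det_apply, Matrix.GeneralLinearGroup.val_det_apply, reindexGL_symm, coe_reindexGL, Matrix.det_reindex_self])

/-! ## §2 The Frobenius embedding `ω ↪ D♭(η)` -/

set_option maxHeartbeats 6400000 in  -- cumulative budget of one long bookkeeping proof over large Jacquet-module terms (as ★ `exists_peel_tower` ∕ (K-c))
/-- **NAA CORE — AN IRREDUCIBLE `ω` WITH `E(ω) = {A¹}` EMBEDS INTO `D♭(η)`.**  `ω` irreducible smooth on `GL₃(F)`, `r_B ω` finite-dimensional, `mult ω A = 1`, `mult ω ζ = 0` for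
`ζ ≠ A`, presented as a subquotient (`ι₁` injective, `π₁` surjective) of a smooth `I` carrying the cell hypothesis at `c = ![0,0,1]`.  Then there is an INJECTIVE intertwining map
`ω → D♭(η) = Ind_{P₂₁}(𝟙.twist ψ_Q(η, ην½⁻¹))` (one ★ S2 peel + `K = ⊥` + the `τ`-eigenfunctional + ★ Frobenius; see the module docstring).
[cite: BernsteinZelevinsky1977, Prop. 1.9, Thm. 2.5, §2.3, Cor. 2.13] [cite: Zelevinsky1980, §1.6, Prop. 2.10, Ex. 3.2] -/
theorem exists_injective_intertwiningMap_D_low (hη : IsOpen ((η.ker : Subgroup Fˣ) : Set Fˣ))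
    {XI X₁ X : Type} [AddCommGroup XI] [Module ℂ XI] [AddCommGroup X₁] [Module ℂ X₁] [AddCommGroup X] [Module ℂ X]
    (I : Representation ℂ (GL (Fin 3) F) XI) (ω₁ : Representation ℂ (GL (Fin 3) F) X₁) (ω : Representation ℂ (GL (Fin 3) F) X) (hI : I.IsSmooth)
    (hcell : ∀ (W : Type) [AddCommGroup W] [Module ℂ W] (σ : Representation ℂ (Π a, GL {i // (![0, 0, 1] : Fin 3 → Fin 2) i = a} F) W),
      σ.IsIrreducible → σ.IsSmooth → σ.IsSupercuspidal → ∀ (N : Subrepresentation (jacquetGL F (![0, 0, 1] : Fin 3 → Fin 2) I)) (q : N.toRepresentation.IntertwiningMap σ), q = 0)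
    (ι₁ : ω₁.IntertwiningMap I) (hι₁ : Function.Injective ι₁) (π₁ : ω₁.IntertwiningMap ω) (hπ₁ : Function.Surjective π₁) [ω.IsIrreducible] (hω : ω.IsSmooth)
    [FiniteDimensional ℂ (Representation.restrictUnipotentGL F (id : Fin 3 → Fin 3) ω).Coinvariants]
    (hA : finrank ℂ ↥(⨅ m, Module.End.maxGenEigenspace (Representation.normalizedJacquetGL F (id : Fin 3 → Fin 3) ω m) (((∏ a : Fin 3, ((![(η * ((unramifiedTwist F (1 / 2) : QuasiChar F).toMonoidHom)⁻¹), (η * ((unramifiedTwist F (1 / 2) : QuasiChar F).toMonoidHom)), (η * ((unramifiedTwist F (1 / 2) : QuasiChar F).toMonoidHom)⁻¹)] : Fin 3 → (Fˣ →* ℂˣ)) a).comp (Matrix.GeneralLinearGroup.det.comp (Pi.evalMonoidHom (fun a : Fin 3 => GL {i : Fin 3 // (id : Fin 3 → Fin 3) i = a} F) a))) m : ℂˣ) : ℂ)) = 1)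
    (h0 : ∀ ζ : (Π a : Fin 3, GL {i : Fin 3 // (id : Fin 3 → Fin 3) i = a} F) → ℂ, ζ ≠ (fun m : (Π a : Fin 3, GL {i : Fin 3 // (id : Fin 3 → Fin 3) i = a} F) => (((∏ a : Fin 3, ((![(η * ((unramifiedTwist F (1 / 2) : QuasiChar F).toMonoidHom)⁻¹), (η * ((unramifiedTwist F (1 / 2) : QuasiChar F).toMonoidHom)), (η * ((unramifiedTwist F (1 / 2) : QuasiChar F).toMonoidHom)⁻¹)] : Fin 3 → (Fˣ →* ℂˣ)) a).comp (Matrix.GeneralLinearGroup.det.comp (Pi.evalMonoidHom (fun a : Fin 3 => GL {i : Fin 3 // (id : Fin 3 → Fin 3) i = a} F) a))) m : ℂˣ) : ℂ)) → finrank ℂ ↥(⨅ m, Module.End.maxGenEigenspace (Representation.normalizedJacquetGL F (id : Fin 3 → Fin 3) ω m) (ζ m)) = 0) :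
    ∃ Φ : ω.IntertwiningMap (Representation.parabolicIndGL F (![false, false, true] : Fin 3 → Bool) ((Representation.trivial ℂ (Π a : Bool, GL {i : Fin 3 // (![false, false, true] : Fin 3 → Bool) i = a} F) ℂ).twist ((η.comp (Matrix.GeneralLinearGroup.det.comp (Pi.evalMonoidHom (fun a : Bool => GL {i : Fin 3 // (![false, false, true] : Fin 3 → Bool) i = a} F) false))) * ((η * ((unramifiedTwist F (1 / 2) : QuasiChar F).toMonoidHom)⁻¹).comp (Matrix.GeneralLinearGroup.det.comp (Pi.evalMonoidHom (fun a : Bool => GL {i : Fin 3 // (![false, false, true] : Fin 3 → Bool) i = a} F) true)))))), Function.Injective Φ := by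
  haveI : IsTopologicalRing F := inferInstance
  obtain ⟨e, he⟩ := exists_blockEquiv_twoOne
  -- (1) the `GL₂`-part `W`, the `GL₁`-action `ζ`, the `T₂ × GL₁`-action `τ` (as in ★ `exists_peel_tower`)
  have hQ := isSmooth_normalizedJacquetGL (![false, false, true] : Fin 3 → Bool) hω
  have hcont : Continuous (((MonoidHom.mulSingle (fun a : Bool => GL {i : Fin 3 // (![false, false, true] : Fin 3 → Bool) i = a} F) false).comp (reindexGL e).toMonoidHom) : GL (Fin 2) F → (Π a : Bool, GL {i : Fin 3 // (![false, false, true] : Fin 3 → Bool) i = a} F)) :=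
    (_root_.continuous_mulSingle false).comp (continuous_reindexGL e)
  have hW : Representation.IsSmooth ((Representation.normalizedJacquetGL F (![false, false, true] : Fin 3 → Bool) ω).comp ((MonoidHom.mulSingle (fun a : Bool => GL {i : Fin 3 // (![false, false, true] : Fin 3 → Bool) i = a} F) false).comp (reindexGL e).toMonoidHom) : Representation ℂ (GL (Fin 2) F) (Representation.restrictUnipotentGL F (![false, false, true] : Fin 3 → Bool) ω).Coinvariants) := IsSmooth.comp_of_continuous _ _ hcont hQ
  have hWζ : ∀ (g : GL (Fin 2) F) (d : GL {i : Fin 3 // (![false, false, true] : Fin 3 → Bool) i = true} F), ((Representation.normalizedJacquetGL F (![false, false, true] : Fin 3 → Bool) ω).comp ((MonoidHom.mulSingle (fun a : Bool => GL {i : Fin 3 // (![false, false, true] : Fin 3 → Bool) i = a} F) false).comp (reindexGL e).toMonoidHom) : Representation ℂ (GL (Fin 2) F) (Representation.restrictUnipotentGL F (![false, false, true] : Fin 3 → Bool) ω).Coinvariants) g * ((Representation.normalizedJacquetGL F (![false, false, true] : Fin 3 → Bool) ω).comp (MonoidHom.mulSingle (fun a : Bool => GL {i : Fin 3 // (![false,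 false, true] : Fin 3 → Bool) i = a} F) true) : Representation ℂ (GL {i : Fin 3 // (![false, false, true] : Fin 3 → Bool) i = true} F) (Representation.restrictUnipotentGL F (![false, false, true] : Fin 3 → Bool) ω).Coinvariants) d = ((Representation.normalizedJacquetGL F (![false, false, true] : Fin 3 → Bool) ω).comp (MonoidHom.mulSingle (fun a : Bool => GL {i : Fin 3 // (![false, false, true] : Fin 3 → Bool) i = a} F) true) : Representation ℂ (GL {i : Fin 3 // (![false, false, true] : Fin 3 → Bool) i = true} F) (Representation.restrictUnipotentGL F (![false, false, true] : Fin 3 → Bool) ω).Coinvariants) d * ((Representation.normalizedJacquetGL F (![false, false, true] : Fin 3 → Bool) ω).comp ((MonoidHom.mulSingle (fun a : Bool => GL {i : Fin 3 // (![false, false, true] : Fin 3 → Bool) i = a} F) false).comp (reindexGL e).toMonoidHom) : Representation ℂ (GL (Fin 2) F) (Representation.restrictUnipotentGL F (![false, false, true] : Fin 3 → Bool) ω).Coinvariants) g := by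
    intro g d
    change (Representation.normalizedJacquetGL F (![false, false, true] : Fin 3 → Bool) ω) (Pi.mulSingle false (reindexGL e g)) * (Representation.normalizedJacquetGL F (![false, false, true] : Fin 3 → Bool) ω) (Pi.mulSingle true d) = (Representation.normalizedJacquetGL F (![false, false, true] : Fin 3 → Bool) ω) (Pi.mulSingle true d) * (Representation.normalizedJacquetGL F (![false, false, true] : Fin 3 → Bool) ω) (Pi.mulSingle false (reindexGL e g))
    rw [← map_mul, ← map_mul, (Pi.mulSingle_commute (by decide) _ _).eq]
  have hτex := exists_prodRep _ _ hWζ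
  obtain ⟨τ, hτ₁, hτ₂⟩ := hτex
  have hEex := exists_linearEquiv_coinvariants_stagesMap e he ω
  obtain ⟨E, -⟩ := hEex
  haveI := Module.Finite.equiv E.symm
  have ha := fun (t : (Π b : Bool, GL {i : Fin 2 // lastBlockLabel 2 i = b} F)) w => LinearMap.congr_fun (hτ₁ t) w
  -- (2) the `τ`-weights: `(a ⊠ aν) ⊗ (a∘det)` once, nothing else
  have hτA : finrank ℂ ↥(⨅ p : (Π b : Bool, GL {i : Fin 2 // lastBlockLabel 2 i = b} F) × GL {i : Fin 3 // (![false, false, true] : Fin 3 → Bool) i = true} F, maxGenEigenspace (τ p) (((maxParabolicLeviChar F 2 (η * ((unramifiedTwist F (1 / 2) : QuasiChar F).toMonoidHom)⁻¹) (η * ((unramifiedTwist F (1 / 2) : QuasiChar F).toMonoidHom)) p.1 : ℂˣ) : ℂ) * ((((η * ((unramifiedTwist F (1 / 2) : QuasiChar F).toMonoidHom)⁻¹)) (Matrix.GeneralLinearGroup.det p.2) : ℂˣ) : ℂ))) = 1 := (finrank_weightSpace_maxParabolicLeviChar_eq_tch e he ω τ ha hτ₂ (η * ((unramifiedTwist F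 (1 / 2) : QuasiChar F).toMonoidHom)⁻¹) (η * ((unramifiedTwist F (1 / 2) : QuasiChar F).toMonoidHom)) (η * ((unramifiedTwist F (1 / 2) : QuasiChar F).toMonoidHom)⁻¹)).trans hA
  have hτC : finrank ℂ ↥(⨅ p : (Π b : Bool, GL {i : Fin 2 // lastBlockLabel 2 i = b} F) × GL {i : Fin 3 // (![false, false, true] : Fin 3 → Bool) i = true} F, maxGenEigenspace (τ p) (((maxParabolicLeviChar F 2 (η * ((unramifiedTwist F (1 / 2) : QuasiChar F).toMonoidHom)) (η * ((unramifiedTwist F (1 / 2) : QuasiChar F).toMonoidHom)⁻¹) p.1 : ℂˣ) : ℂ) * ((((η * ((unramifiedTwist F (1 / 2) : QuasiChar F).toMonoidHom)⁻¹)) (Matrix.GeneralLinearGroup.det p.2) : ℂˣ) : ℂ))) = 0 := (finrank_weightSpace_maxParabolicLeviChar_eq_tch e he ω τ ha hτ₂ (η * ((unramifiedTwist F (1 / 2) : QuasiChar F).toMonoidHom)) (η * ((unramifiedTwist F (1 / 2) : QuasiChar F).toMonoidHom)⁻¹) (η * ((unramifiedTwist F (1 / 2) : QuasiChar F).toMonoidHom)⁻¹)).trans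 (h0 _ (tch_C_ne_A η))
  have hτother : ∀ χ' : (Π b : Bool, GL {i : Fin 2 // lastBlockLabel 2 i = b} F) × GL {i : Fin 3 // (![false, false, true] : Fin 3 → Bool) i = true} F → ℂ, χ' ≠ (fun p : (Π b : Bool, GL {i : Fin 2 // lastBlockLabel 2 i = b} F) × GL {i : Fin 3 // (![false, false, true] : Fin 3 → Bool) i = true} F => ((maxParabolicLeviChar F 2 (η * ((unramifiedTwist F (1 / 2) : QuasiChar F).toMonoidHom)⁻¹) (η * ((unramifiedTwist F (1 / 2) : QuasiChar F).toMonoidHom)) p.1 : ℂˣ) : ℂ) * ((((η * ((unramifiedTwist F (1 / 2) : QuasiChar F).toMonoidHom)⁻¹)) (Matrix.GeneralLinearGroup.det p.2) : ℂˣ) : ℂ)) → finrank ℂ ↥(⨅ p : (Π b : Bool, GL {i : Fin 2 // lastBlockLabel 2 i = b} F) × GL {i : Fin 3 // (![false, false, true] : Fin 3 → Bool) i = true} F, maxGenEigenspace (τ p) (χ' p)) = 0 := by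
    intro χ' hχ'
    rw [finrank_weightSpace_eq_of_comp_mu e he ω τ ha hτ₂ χ' _ (fun m => rfl)]
    refine h0 _ fun hEq => hχ' ?_
    funext p
    obtain ⟨m, rfl⟩ := mu_surjective e he p
    have h1 := congrFun hEq m
    have h2 := tch_eq_mu e he (η * ((unramifiedTwist F (1 / 2) : QuasiChar F).toMonoidHom)⁻¹) (η * ((unramifiedTwist F (1 / 2) : QuasiChar F).toMonoidHom)) (η * ((unramifiedTwist F (1 / 2) : QuasiChar F).toMonoidHom)⁻¹) m
    exact h1.trans h2
  -- (3) ONE peel: `K ≤ W`, `W ⁄ K ≅ η∘det`, all `τ_K`-weights vanish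
  have hpeel := exists_peel_linked block_true_mul_comm _ hW _ hWζ τ hτ₁ hτ₂ η hη (fun d : GL {i : Fin 3 // (![false, false, true] : Fin 3 → Bool) i = true} F => ((((η * ((unramifiedTwist F (1 / 2) : QuasiChar F).toMonoidHom)⁻¹)) (Matrix.GeneralLinearGroup.det d) : ℂˣ) : ℂ))
      (fun hbot => by rw [hbot, finrank_bot] at hτA; exact absurd hτA (by norm_num))
      ((Submodule.finrank_eq_zero).1 hτC)
  obtain ⟨K, ζK, τK, -, -, -, -, -, hfdK, -, hmultK, hotherK, ⟨e₁⟩⟩ := hpeel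
  haveI := hfdK
  have hKsub : Subsingleton (Representation.restrictUnipotentGL F (lastBlockLabel 2) K.toRepresentation).Coinvariants := by
    refine subsingleton_of_forall_weightSpace_eq_bot τK (commute_prodRep block_true_mul_comm τK) fun χ' => ?_
    apply (Submodule.finrank_eq_zero).1
    by_cases hχ : χ' = (fun p : (Π b : Bool, GL {i : Fin 2 // lastBlockLabel 2 i = b} F) × GL {i : Fin 3 // (![false, false, true] : Fin 3 → Bool) i = true} F => ((maxParabolicLeviChar F 2 (η * ((unramifiedTwist F (1 / 2) : QuasiChar F).toMonoidHom)⁻¹) (η * ((unramifiedTwist F (1 / 2) : QuasiChar F).toMonoidHom)) p.1 : ℂˣ) : ℂ) * ((((η * ((unramifiedTwist F (1 / 2) : QuasiChar F).toMonoidHom)⁻¹)) (Matrix.GeneralLinearGroup.det p.2) : ℂˣ) : ℂ))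
    · subst hχ; beta_reduce; omega
    · rw [← hotherK _ hχ]; exact hτother χ' hχ
  -- (4) `K = ⊥`
  have hKbot : K = ⊥ := eq_bot_of_subsingleton_coinvariants e he I ω₁ ω hI hcell ι₁ hι₁ π₁ hπ₁ hω K hKsub
  -- (5) `W` acts on ALL of `r̄_Q ω` through `η∘det`
  have hWact : ∀ (g : GL (Fin 2) F) (x : (Representation.restrictUnipotentGL F (![false, false, true] : Fin 3 → Bool) ω).Coinvariants), ((Representation.normalizedJacquetGL F (![false, false, true] : Fin 3 → Bool) ω).comp ((MonoidHom.mulSingle (fun a : Bool => GL {i : Fin 3 // (![false, false, true] : Fin 3 → Bool) i = a} F) false).comp (reindexGL e).toMonoidHom) : Representation ℂ (GL (Fin 2) F) (Representation.restrictUnipotentGL F (![false, false, true] : Fin 3 → Bool) ω).Coinvariants) g x = (((η.comp (Matrix.GeneralLinearGroup.det : GL (Fin 2) F →* Fˣ)) g : ℂˣ) : ℂ) • x := by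
    intro g x
    have h1 := Representation.IntertwiningMap.isIntertwining _ _ e₁.toIntertwiningMap g (Submodule.Quotient.mk x)
    rw [Subrepresentation.quotientRep_mk, Representation.twist_apply, Representation.trivial_apply, ← map_smul, ← Submodule.Quotient.mk_smul] at h1
    simp only [Representation.Equiv.coe_toIntertwiningMap] at h1
    have h2 := (Submodule.Quotient.eq K.toSubmodule).1 (EquivLike.injective e₁ h1)
    rw [hKbot] at h2
    exact sub_eq_zero.1 ((Submodule.mem_bot ℂ).1 h2)
  -- (6) the `τ`-eigenfunctional `λ` of weight `(a⊠aν)⊗(a∘det)` and the `M`-intertwiner `q = λ ∘ mk`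
  have hneA : (⨅ p : (Π b : Bool, GL {i : Fin 2 // lastBlockLabel 2 i = b} F) × GL {i : Fin 3 // (![false, false, true] : Fin 3 → Bool) i = true} F, maxGenEigenspace (τ p) (((maxParabolicLeviChar F 2 (η * ((unramifiedTwist F (1 / 2) : QuasiChar F).toMonoidHom)⁻¹) (η * ((unramifiedTwist F (1 / 2) : QuasiChar F).toMonoidHom)) p.1 : ℂˣ) : ℂ) * ((((η * ((unramifiedTwist F (1 / 2) : QuasiChar F).toMonoidHom)⁻¹)) (Matrix.GeneralLinearGroup.det p.2) : ℂˣ) : ℂ))) ≠ ⊥ := fun hbot => by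
    rw [hbot, finrank_bot] at hτA; exact absurd hτA (by norm_num)
  have hlex := exists_functional_of_weightSpace_ne_bot τ (commute_prodRep block_true_mul_comm τ) (fun p : (Π b : Bool, GL {i : Fin 2 // lastBlockLabel 2 i = b} F) × GL {i : Fin 3 // (![false, false, true] : Fin 3 → Bool) i = true} F => ((maxParabolicLeviChar F 2 (η * ((unramifiedTwist F (1 / 2) : QuasiChar F).toMonoidHom)⁻¹) (η * ((unramifiedTwist F (1 / 2) : QuasiChar F).toMonoidHom)) p.1 : ℂˣ) : ℂ) * ((((η * ((unramifiedTwist F (1 / 2) : QuasiChar F).toMonoidHom)⁻¹)) (Matrix.GeneralLinearGroup.det p.2) : ℂˣ) : ℂ)) hneA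
  obtain ⟨l, hl0, hl⟩ := hlex
  have hqW : ∀ (g : GL (Fin 2) F) (x : (Representation.restrictUnipotentGL F (![false, false, true] : Fin 3 → Bool) ω).Coinvariants), l (Representation.Coinvariants.mk (Representation.restrictUnipotentGL F (lastBlockLabel 2) ((Representation.normalizedJacquetGL F (![false, false, true] : Fin 3 → Bool) ω).comp ((MonoidHom.mulSingle (fun a : Bool => GL {i : Fin 3 // (![false, false, true] : Fin 3 → Bool) i = a} F) false).comp (reindexGL e).toMonoidHom) : Representation ℂ (GL (Fin 2) F) (Representation.restrictUnipotentGL F (![false, false, true] : Fin 3 → Bool) ω).Coinvariants)) (((Representation.normalizedJacquetGL F (![false, false, true] : Fin 3 → Bool) ω).comp ((MonoidHom.mulSingle (fun a : Bool => GL {i : Fin 3 // (![false, false, true] : Fin 3 → Bool) i = a} F) false).comp (reindexGL e).toMonoidHom) : Representation ℂ (GL (Fin 2) F) (Representation.restrictUnipotentGL F (![false, false, true] : Fin 3 → Bool) ω).Coinvariants) g x)) =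
      (((η.comp (Matrix.GeneralLinearGroup.det : GL (Fin 2) F →* Fˣ)) g : ℂˣ) : ℂ) * l (Representation.Coinvariants.mk (Representation.restrictUnipotentGL F (lastBlockLabel 2) ((Representation.normalizedJacquetGL F (![false, false, true] : Fin 3 → Bool) ω).comp ((MonoidHom.mulSingle (fun a : Bool => GL {i : Fin 3 // (![false, false, true] : Fin 3 → Bool) i = a} F) false).comp (reindexGL e).toMonoidHom) : Representation ℂ (GL (Fin 2) F) (Representation.restrictUnipotentGL F (![false, false, true] : Fin 3 → Bool) ω).Coinvariants)) x) := by
    intro g x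
    rw [hWact, map_smul, map_smul, smul_eq_mul]
  have hqζ : ∀ (d : GL {i : Fin 3 // (![false, false, true] : Fin 3 → Bool) i = true} F) (x : (Representation.restrictUnipotentGL F (![false, false, true] : Fin 3 → Bool) ω).Coinvariants), l (Representation.Coinvariants.mk (Representation.restrictUnipotentGL F (lastBlockLabel 2) ((Representation.normalizedJacquetGL F (![false, false, true] : Fin 3 → Bool) ω).comp ((MonoidHom.mulSingle (fun a : Bool => GL {i : Fin 3 // (![false, false, true] : Fin 3 → Bool) i = a} F) false).comp (reindexGL e).toMonoidHom) : Representation ℂ (GL (Fin 2) F) (Representation.restrictUnipotentGL F (![false, false, true] : Fin 3 → Bool) ω).Coinvariants)) (((Representation.normalizedJacquetGL F (![false, false, true] : Fin 3 → Bool) ω).comp (MonoidHom.mulSingle (fun a : Bool => GL {i : Fin 3 // (![false, false, true] : Fin 3 → Bool) i = a} F) true) : Representation ℂ (GL {i : Fin 3 // (![false, false, true] : Fin 3 → Bool) i = true} F) (Representation.restrictUnipotentGL F (![false, false, true] : Fin 3 → Bool) ω).Coinvariants) d x)) =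
      ((((η * ((unramifiedTwist F (1 / 2) : QuasiChar F).toMonoidHom)⁻¹)) (Matrix.GeneralLinearGroup.det d) : ℂˣ) : ℂ) * l (Representation.Coinvariants.mk (Representation.restrictUnipotentGL F (lastBlockLabel 2) ((Representation.normalizedJacquetGL F (![false, false, true] : Fin 3 → Bool) ω).comp ((MonoidHom.mulSingle (fun a : Bool => GL {i : Fin 3 // (![false, false, true] : Fin 3 → Bool) i = a} F) false).comp (reindexGL e).toMonoidHom) : Representation ℂ (GL (Fin 2) F) (Representation.restrictUnipotentGL F (![false, false, true] : Fin 3 → Bool) ω).Coinvariants)) x) := by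
    intro d x
    rw [← hτ₂ d x, hl]
    simp only [map_one, Units.val_one, one_mul]
  have hq : ∀ (m : (Π a : Bool, GL {i : Fin 3 // (![false, false, true] : Fin 3 → Bool) i = a} F)) (x : (Representation.restrictUnipotentGL F (![false, false, true] : Fin 3 → Bool) ω).Coinvariants), l (Representation.Coinvariants.mk (Representation.restrictUnipotentGL F (lastBlockLabel 2) ((Representation.normalizedJacquetGL F (![false, false, true] : Fin 3 → Bool) ω).comp ((MonoidHom.mulSingle (fun a : Bool => GL {i : Fin 3 // (![false, false, true] : Fin 3 → Bool) i = a} F) false).comp (reindexGL e).toMonoidHom) : Representation ℂ (GL (Fin 2) F) (Representation.restrictUnipotentGL F (![false, false, true] : Fin 3 → Bool) ω).Coinvariants)) ((Representation.normalizedJacquetGL F (![false, false, true] : Fin 3 → Bool) ω) m x)) =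
      ((((η.comp (Matrix.GeneralLinearGroup.det.comp (Pi.evalMonoidHom (fun a : Bool => GL {i : Fin 3 // (![false, false, true] : Fin 3 → Bool) i = a} F) false))) * ((η * ((unramifiedTwist F (1 / 2) : QuasiChar F).toMonoidHom)⁻¹).comp (Matrix.GeneralLinearGroup.det.comp (Pi.evalMonoidHom (fun a : Bool => GL {i : Fin 3 // (![false, false, true] : Fin 3 → Bool) i = a} F) true)))) m : ℂˣ) : ℂ) * l (Representation.Coinvariants.mk (Representation.restrictUnipotentGL F (lastBlockLabel 2) ((Representation.normalizedJacquetGL F (![false, false, true] : Fin 3 → Bool) ω).comp ((MonoidHom.mulSingle (fun a : Bool => GL {i : Fin 3 // (![false, false, true] : Fin 3 → Bool) i = a} F) false).comp (reindexGL e).toMonoidHom) : Representation ℂ (GL (Fin 2) F) (Representation.restrictUnipotentGL F (![false, false, true] : Fin 3 → Bool) ω).Coinvariants)) x) := by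
    intro m x
    have hnJ : (Representation.normalizedJacquetGL F (![false, false, true] : Fin 3 → Bool) ω) m = (Representation.normalizedJacquetGL F (![false, false, true] : Fin 3 → Bool) ω) (Pi.mulSingle false (m false)) * (Representation.normalizedJacquetGL F (![false, false, true] : Fin 3 → Bool) ω) (Pi.mulSingle true (m true)) := by
      rw [← map_mul, mulSingle_false_mul_mulSingle_true]
    have hf : (Representation.normalizedJacquetGL F (![false, false, true] : Fin 3 → Bool) ω) (Pi.mulSingle false (m false)) = ((Representation.normalizedJacquetGL F (![false, false, true] : Fin 3 → Bool) ω).comp ((MonoidHom.mulSingle (fun a : Bool => GL {i : Fin 3 // (![false, false, true] : Fin 3 → Bool) i = a} F) false).comp (reindexGL e).toMonoidHom) : Representation ℂ (GL (Fin 2) F) (Representation.restrictUnipotentGL F (![false, false, true] : Fin 3 → Bool) ω).Coinvariants) ((reindexGL e).symm (m false)) := by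
      change _ = (Representation.normalizedJacquetGL F (![false, false, true] : Fin 3 → Bool) ω) (((MonoidHom.mulSingle (fun a : Bool => GL {i : Fin 3 // (![false, false, true] : Fin 3 → Bool) i = a} F) false).comp (reindexGL e).toMonoidHom) ((reindexGL e).symm (m false)))
      rw [MonoidHom.comp_apply, MulEquiv.coe_toMonoidHom, MulEquiv.apply_symm_apply, MonoidHom.mulSingle_apply]
    have ht : (Representation.normalizedJacquetGL F (![false, false, true] : Fin 3 → Bool) ω) (Pi.mulSingle true (m true)) = ((Representation.normalizedJacquetGL F (![false, false, true] : Fin 3 → Bool) ω).comp (MonoidHom.mulSingle (fun a : Bool => GL {i : Fin 3 // (![false, false, true] : Fin 3 → Bool) i = a} F) true) : Representation ℂ (GL {i : Fin 3 // (![false, false, true] : Fin 3 → Bool) i = true} F) (Representation.restrictUnipotentGL F (![false, false, true] : Fin 3 → Bool) ω).Coinvariants) (m true) := rfl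
    have hψ : ((((η.comp (Matrix.GeneralLinearGroup.det.comp (Pi.evalMonoidHom (fun a : Bool => GL {i : Fin 3 // (![false, false, true] : Fin 3 → Bool) i = a} F) false))) * ((η * ((unramifiedTwist F (1 / 2) : QuasiChar F).toMonoidHom)⁻¹).comp (Matrix.GeneralLinearGroup.det.comp (Pi.evalMonoidHom (fun a : Bool => GL {i : Fin 3 // (![false, false, true] : Fin 3 → Bool) i = a} F) true)))) m : ℂˣ) : ℂ) = ((η (Matrix.GeneralLinearGroup.det (m false)) : ℂˣ) : ℂ) * ((((η * ((unramifiedTwist F (1 / 2) : QuasiChar F).toMonoidHom)⁻¹)) (Matrix.GeneralLinearGroup.det (m true)) : ℂˣ) : ℂ) := by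
      simp only [MonoidHom.mul_apply, MonoidHom.comp_apply, Pi.evalMonoidHom_apply, Units.val_mul]
    rw [hnJ, Module.End.mul_apply, hf, ht, hqW, hqζ, ← mul_assoc, hψ, MonoidHom.comp_apply, det_reindexGL_symm]
  let Q : ((Representation.normalizedJacquetGL F (![false, false, true] : Fin 3 → Bool) ω)).IntertwiningMap ((Representation.trivial ℂ (Π a : Bool, GL {i : Fin 3 // (![false, false, true] : Fin 3 → Bool) i = a} F) ℂ).twist ((η.comp (Matrix.GeneralLinearGroup.det.comp (Pi.evalMonoidHom (fun a : Bool => GL {i : Fin 3 // (![false, false, true] : Fin 3 → Bool) i = a} F) false))) * ((η * ((unramifiedTwist F (1 / 2) : QuasiChar F).toMonoidHom)⁻¹).comp (Matrix.GeneralLinearGroup.det.comp (Pi.evalMonoidHom (fun a : Bool => GL {i : Fin 3 // (![false, false, true] : Fin 3 → Bool) i = a} F) true))))) :=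
    ⟨l ∘ₗ Representation.Coinvariants.mk (Representation.restrictUnipotentGL F (lastBlockLabel 2) ((Representation.normalizedJacquetGL F (![false, false, true] : Fin 3 → Bool) ω).comp ((MonoidHom.mulSingle (fun a : Bool => GL {i : Fin 3 // (![false, false, true] : Fin 3 → Bool) i = a} F) false).comp (reindexGL e).toMonoidHom) : Representation ℂ (GL (Fin 2) F) (Representation.restrictUnipotentGL F (![false, false, true] : Fin 3 → Bool) ω).Coinvariants)), fun m => LinearMap.ext fun x => by
      rw [LinearMap.comp_apply, LinearMap.comp_apply, LinearMap.comp_apply, LinearMap.comp_apply, Representation.twist_apply, Representation.trivial_apply, smul_eq_mul]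
      exact hq m x⟩
  have hQ0 : Q ≠ 0 := by
    intro hQ
    apply hl0
    refine LinearMap.ext fun w => ?_
    obtain ⟨x, rfl⟩ := Representation.Coinvariants.mk_surjective _ w
    have hx : Q x = 0 := by rw [hQ]; rfl
    exact hx
  -- (7) Frobenius
  obtain ⟨fr⟩ := frobenius_reciprocity_gl_holds (V := X) (W := ℂ) F (![false, false, true] : Fin 3 → Bool) ω hω ((Representation.trivial ℂ (Π a : Bool, GL {i : Fin 3 // (![false, false, true] : Fin 3 → Bool) i = a} F) ℂ).twist ((η.comp (Matrix.GeneralLinearGroup.det.comp (Pi.evalMonoidHom (fun a : Bool => GL {i : Fin 3 // (![false, false, true] : Fin 3 → Bool) i = a} F) false))) * ((η * ((unramifiedTwist F (1 / 2) : QuasiChar F).toMonoidHom)⁻¹).comp (Matrix.GeneralLinearGroup.det.comp (Pi.evalMonoidHom (fun a : Bool => GL {i : Fin 3 // (![false, false, true] : Fin 3 → Bool) i = a} F) true)))))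
  exact ⟨fr.symm Q, (Representation.IsIrreducible.injective_or_eq_zero (fr.symm Q)).resolve_right fun h0' => hQ0 (fr.symm.map_eq_zero_iff.1 h0')⟩

end Summit.HodgeConjecture.HodgeConjecture.Cruxes.H413.K2E3GL3NoWeightAAloneEmbedding

end
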